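import Summits.QuantumFields.GaugeBoot.StaggeredParityTwist
import Summits.QuantumFields.GaugeBoot.Targets
import HarnessLib

/-!
# Link reflection positivity of the even torus at EVERY real coupling for `U(N)`, `SU(2)`, `SU(2n)`;
# the `SU(2n)` plaquette expectation is odd in `β` (gauge-boot, L3 structural supplement, part 3 of 3)

HONEST FRAMING (cell `pub-gaugeboot`, page 1 of every file): the venture produces certified bounds
on lattice expectations at stated coupling, gauge group, dimension and torus size; NOT a mass gap,
NOT a continuum limit, NOT a string tension; NOT Yang–Mills-summit-bearing (barriers
`FixedCouplingUltralocality`, `PerturbativeInvisibility`). This module bounds no expectation; no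
certificate of the cell sits at `β < 0`.

Parts 1–2 (`StaggeredCentralTwist.lean`, `StaggeredParityTwist.lean`): on a finite periodic
lattice with mod-2 coordinate parities, the Kogut–Susskind staggered central twist by a central
`z` with `z² = 1`, `ρ z = -1` maps the Wilson measure at `β` onto the one at `-β`, commutes with the
site/link reflections of a site frame along the last axis, and yields link reflection positivity at
every real `β`. Here: THE CUBIC TORUS OF EVEN SIDE, the volume of every certificate of the cell.

* `cubicParity d L h2 m : Site d L →+ ℤ/2` (`x ↦ x_m mod 2`, `2 ∣ L`), `isDualParity_cubicParity`,
  `cubicParity_cubicAxisReflect` (the parities off `r` are even under `x_r ↦ -x_r`);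
* `cubicTorus_integral_comp_stagTwist` — on `(ℤ/L)^d`, `L` even, `L ≥ 1`:
  `∫ F(T U) dμ_β = ∫ F dμ_{-β}` for the torus Wilson measure `wilsonMeasure ρ β` of
  `ConstructiveQFTWave0` and EVERY `F` (compact second countable `G`, continuous `ρ`, `ρ z = -1`);
  `meanPlaquette_centralTwist` (`ū_P(T U) = -ū_P(U)`);
* ★★ `cubicTorus_linkRP_anyBeta_of_central`, `cubicTorus_linkRP_blocks_nonneg_anyBeta_of_central` —
  LINK (mid-plane `x_k = ½`) REFLECTION POSITIVITY of `wilsonMeasure ρ β` along EVERY axis `k` of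
  `(ℤ/2Q)^d`, `Q ≥ 2`, at EVERY REAL `β`, for a compact second countable `G` with a central
  involution `z` and continuous `ρ` with `ρ z = -1`; PSD link RP blocks;
* the venture's groups: ★ `cubicTorus_linkRP_uN_anyBeta` (`U(N)`, every `N ≥ 1`... and `N = 0`),
  ★ `cubicTorus_linkRP_su2_anyBeta` (`SU(2)`), `cubicTorus_linkRP_suEven_anyBeta` (`SU(M)`, `M`
  even), via `neg_one_mem_specialUnitaryGroup_of_even` (`-1 ∈ SU(M)` iff... for `M` even);
* ★ `plaquetteExpectation_neg_of_even` — in the cell's own vocabulary (`Targets.lean`): for `M`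
  even (so `SU(2)`), every `D`, every EVEN torus side `L` and every real `β_std`,
  `⟨ū_P⟩_{(ℤ/L)^D, SU(M), -β_std} = -⟨ū_P⟩_{(ℤ/L)^D, SU(M), β_std}` (Li–Meurice's `P(β) + P(-β) = 2`);
  hence `plaquetteWindow_neg_of_even`, `t1_neg`, `t2_neg`: EVERY plaquette window
  `PlaquetteWindow M D L₀ β a b` (all even `L ≥ L₀`) is the window `[-b, -a]` at `-β` — the cell's
  `SU(2)` rows T1/T2 hold verbatim at the negated coupling with the negated window.

What is NOT claimed: nothing for `SU(3)` (`T3`, `T4`): `-1 ∉ SU(3)` and no central element has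
`ρ z = -1`; its plaquette expectation is NOT odd in `β` and its link RP at `β < 0` is neither proved
nor refuted here. Nothing for the diagonal family, nothing about infinite volume, no new certificate.

References: L. Li, Y. Meurice, Phys. Rev. D 71 (2005) 016008 §II; Y. Meurice, PoS LAT2009
(arXiv:0910.5785) p. 3; K. Osterwalder, E. Seiler, Ann. Phys. 110 (1978) 440 §2; V. Kazakov,
Z. Zheng, arXiv:2203.11360 §3.1.
-/

noncomputable section

open MeasureTheory Complex
open scoped ComplexOrder ComplexConjugate
open Literature.MathematicalPhysics.QuantumFieldTheory (haarProbability Site GaugeConfig Plaquette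
  wilsonMeasure wilsonExpectation)
open Literature.MathematicalPhysics.QuantumLattice (fundamentalRep unitaryFundamentalRep
  continuous_fundamentalRep continuous_unitaryFundamentalRep fundamentalRep_apply
  unitaryFundamentalRep_apply)
open Literature.RepresentationTheory.CompactGroups

namespace Summit.QuantumFields.GaugeBoot

namespace TiltedRP

/-! ## Mod-2 coordinate parities of the even cubic torus -/

section Parity

variable (d L : ℕ)

/-- **The parity `x ↦ x_m mod 2`** of the cubic torus `(ℤ/L)^d` of even side (an additive map
`Site d L →+ ℤ/2`). -/
def cubicParity (h2 : 2 ∣ L) (m : Fin d) : Site d L →+ ZMod 2 :=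
  (ZMod.castHom h2 (ZMod 2)).toAddMonoidHom.comp (cubicAxisCoord d L m)

/-- `cubicParity` evaluated. -/
@[simp] theorem cubicParity_apply (h2 : 2 ∣ L) (m : Fin d) (x : Site d L) :
    cubicParity d L h2 m x = ZMod.castHom h2 (ZMod 2) (x m) := rfl

/-- **The parities are dual to the unit vectors**: `(e_k)_m mod 2 = [m = k]`. -/
theorem isDualParity_cubicParity (h2 : 2 ∣ L) : IsDualParity (cubicUnit d L) (cubicParity d L h2) := by
  intro m k
  rw [cubicParity_apply, cubicUnit_apply]
  split_ifs
  · exact map_one _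
  · exact map_zero _

/-- **The parities off the axis `r` are invariant under the reflection `x_r ↦ -x_r`.** -/
theorem cubicParity_cubicAxisReflect (h2 : 2 ∣ L) {m r : Fin d} (hm : m ≠ r) (x : Site d L) :
    cubicParity d L h2 m (cubicAxisReflect d L r x) = cubicParity d L h2 m x := by
  rw [cubicParity_apply, cubicParity_apply, cubicAxisReflect_apply, if_neg hm]

end Parity

/-! ## The twist on the torus Wilson measure; link RP at every real `β` -/

section Torus

variable {d L N : ℕ}
variable {G : Type} [Group G] [TopologicalSpace G] [IsTopologicalGroup G] [CompactSpace G]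
  [MeasurableSpace G] [BorelSpace G] [SecondCountableTopology G]
variable (ρ : G →* Matrix (Fin N) (Fin N) ℂ)

/-- **The staggered central twist maps the torus Wilson measure at `β` onto the one at `-β`**:
on `(ℤ/L)^d` with `L` even, for a compact second countable `G`, a central `z` with `z² = 1`, a
continuous `ρ` with `ρ z = -1`, every axis `r` (put last in the staggering) and EVERY `F`,
`∫ F(T U) dμ_β(U) = ∫ F dμ_{-β}`, `μ_β = wilsonMeasure ρ β`. -/
theorem cubicTorus_integral_comp_stagTwist [NeZero L] (h2 : 2 ∣ L) (r : Fin d) (hρ : Continuous ρ)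
    {z : G} (hzc : ∀ g, z * g = g * z) (hz2 : z * z = 1) (hρz : ρ z = -1) (β : ℝ)
    {V : Type*} [NormedAddCommGroup V] [NormedSpace ℝ V] (F : GaugeConfig d L G → V) :
    ∫ U, F (centralTwist (stagTwist (cubicParity d L h2) r z) U) ∂(wilsonMeasure (d := d) (L := L) ρ β)
      = ∫ U, F U ∂(wilsonMeasure (d := d) (L := L) ρ (-β)) := by
  rw [← gibbs_cubicUnit_eq_wilsonMeasure ρ hρ β, ← gibbs_cubicUnit_eq_wilsonMeasure ρ hρ (-β)]
  exact (isStaggering_stagTwist (isDualParity_cubicParity d L h2) r hzc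
    hz2).integral_comp_centralTwist_gibbs ρ hρz β F

omit [TopologicalSpace G] [IsTopologicalGroup G] [CompactSpace G] [MeasurableSpace G] [BorelSpace G]
  [SecondCountableTopology G] in
/-- **The torus-averaged plaquette changes sign under a staggering of the cubic torus**:
`ū_P(T_s U) = -ū_P(U)` (`ρ z = -1`). -/
theorem meanPlaquette_centralTwist [NeZero L] {z : G} {s : Link (Site d L) d → G}
    (hs : IsStaggering (cubicUnit d L) z s) (hρz : ρ z = -1) (U : GaugeConfig d L G) :
    meanPlaquette ρ (centralTwist s U) = -meanPlaquette ρ U := by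
  unfold meanPlaquette
  rw [← mul_neg, ← Finset.sum_neg_distrib]
  congr 1
  refine Finset.sum_congr rfl fun p _ => ?_
  unfold plaquetteTrace
  rw [← holonomy_cubicUnit, ← holonomy_cubicUnit, hs.holonomy_centralTwist U p.1 (ne_of_lt p.2.2),
    map_mul, hρz, neg_one_mul, Matrix.trace_neg, Complex.neg_re, mul_neg]

variable {Q : ℕ} [NeZero Q]

/-- ★★ **Link (mid-plane) reflection positivity of the torus Wilson measure along every axis at
EVERY real `β`, for gauge groups with a central involution represented by `-1`.** On the even torus
`(ℤ/2Q)^d`, `Q ≥ 2`, for a compact second countable `G`, a central `z ∈ G` with `z² = 1`, a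
continuous `ρ` with `ρ z = -1`, every axis `k`, every real `β` and every bounded measurable `F`
depending only on the links with both endpoints in `{1 ≤ x_k ≤ Q}`:
`0 ≤ ∫ conj F(ΘU) · F(U) dμ_β(U)`, `Θ` the reflection in `x_k = ½`. (`β ≥ 0`: `cubicTorus_linkRP`;
`β < 0`: the staggered central twist with `k` last carries it onto `-β`.) -/
theorem cubicTorus_linkRP_anyBeta_of_central (hQ : 2 ≤ Q) (k : Fin d) (hρ : Continuous ρ) {z : G}
    (hzc : ∀ g, z * g = g * z) (hz2 : z * z = 1) (hρz : ρ z = -1) (β : ℝ)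
    (F : GaugeConfig d (2 * Q) G → ℂ) (hFm : Measurable F) (hFb : ∃ C : ℝ, ∀ U, ‖F U‖ ≤ C)
    (hFo : IsMidObservable (cubicUnit d (2 * Q)) Q (cubicAxisCoord d (2 * Q) k) F) :
    0 ≤ ∫ U, conj (F (configMidReflect (cubicUnit d (2 * Q)) k (cubicAxisReflect d (2 * Q) k) U)) *
      F U ∂(wilsonMeasure (d := d) (L := 2 * Q) ρ β) := by
  rw [← gibbs_cubicUnit_eq_wilsonMeasure ρ hρ β]
  exact (isSiteFrame_cubicTorus d hQ k).linkRP_integral_conj_mul_nonneg_anyBeta_of_twist ρ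
    (isDualParity_cubicParity d (2 * Q) (dvd_mul_right 2 Q))
    (fun m hm x => cubicParity_cubicAxisReflect d (2 * Q) _ hm x) hzc hz2 hρ hρz β F hFm hFb hFo

/-- **The link RP blocks of the even torus are positive semidefinite at every real `β`** (same
hypotheses): for bounded measurable observables `F_1, …, F_n` of `{1 ≤ x_k ≤ Q}` and `c ∈ ℂ^n`,
`0 ≤ ∑_{a,b} conj c_a · c_b · ⟨conj(F_a ∘ Θ) F_b⟩_β`. -/
theorem cubicTorus_linkRP_blocks_nonneg_anyBeta_of_central (hQ : 2 ≤ Q) (k : Fin d)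
    (hρ : Continuous ρ) {z : G} (hzc : ∀ g, z * g = g * z) (hz2 : z * z = 1) (hρz : ρ z = -1)
    (β : ℝ) {n : ℕ} (F : Fin n → GaugeConfig d (2 * Q) G → ℂ) (hFm : ∀ a, Measurable (F a))
    (hFb : ∀ a, ∃ C : ℝ, ∀ U, ‖F a U‖ ≤ C)
    (hFo : ∀ a, IsMidObservable (cubicUnit d (2 * Q)) Q (cubicAxisCoord d (2 * Q) k) (F a))
    (c : Fin n → ℂ) :
    0 ≤ ∑ a, ∑ b, conj (c a) * c b *
      ∫ U, conj (F a (configMidReflect (cubicUnit d (2 * Q)) k (cubicAxisReflect d (2 * Q) k) U)) *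
        F b U ∂(wilsonMeasure (d := d) (L := 2 * Q) ρ β) := by
  rw [← gibbs_cubicUnit_eq_wilsonMeasure ρ hρ β]
  exact (isSiteFrame_cubicTorus d hQ k).linkRP_sum_mul_conj_integral_nonneg_anyBeta_of_twist ρ
    (isDualParity_cubicParity d (2 * Q) (dvd_mul_right 2 Q))
    (fun m hm x => cubicParity_cubicAxisReflect d (2 * Q) _ hm x) hzc hz2 hρ hρz β F hFm hFb hFo c

end Torus

/-! ## The venture's groups with a central involution: `U(N)`, `SU(2)`, `SU(2n)` -/

section GaugeGroups

variable {d Q N : ℕ} [NeZero Q]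

/-- ★ **Link-hyperplane RP of `U(N)` lattice gauge theory on the even torus along every axis at
EVERY real `β`** (fundamental representation, `z = -1 ∈ U(N)`; `Q ≥ 2`; every `N`, `U(1)`
included). -/
theorem cubicTorus_linkRP_uN_anyBeta (hQ : 2 ≤ Q) (k : Fin d) (β : ℝ)
    (F : GaugeConfig d (2 * Q) (Matrix.unitaryGroup (Fin N) ℂ) → ℂ) (hFm : Measurable F)
    (hFb : ∃ C : ℝ, ∀ U, ‖F U‖ ≤ C)
    (hFo : IsMidObservable (cubicUnit d (2 * Q)) Q (cubicAxisCoord d (2 * Q) k) F) :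
    0 ≤ ∫ U, conj (F (configMidReflect (cubicUnit d (2 * Q)) k (cubicAxisReflect d (2 * Q) k) U)) *
      F U ∂(wilsonMeasure (d := d) (L := 2 * Q) (unitaryFundamentalRep (Fin N) ℂ) β) := by
  haveI : SecondCountableTopology (Matrix (Fin N) (Fin N) ℂ) :=
    inferInstanceAs (SecondCountableTopology (Fin N → Fin N → ℂ))
  haveI : SecondCountableTopology (Matrix.unitaryGroup (Fin N) ℂ) :=
    Topology.IsEmbedding.subtypeVal.secondCountableTopology
  refine cubicTorus_linkRP_anyBeta_of_central (unitaryFundamentalRep (Fin N) ℂ) hQ k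
    (continuous_unitaryFundamentalRep (n := Fin N) (𝕜 := ℂ)) (z := -1) (fun g => ?_) ?_ ?_ β F hFm
    hFb hFo
  · rw [neg_one_mul, mul_neg_one]
  · rw [neg_one_mul, neg_neg]
  · rw [unitaryFundamentalRep_apply, Unitary.coe_neg, OneMemClass.coe_one]

/-- **`-1 ∈ SU(M)` for `M` even** (`det(-1) = (-1)^M = 1`). -/
theorem neg_one_mem_specialUnitaryGroup_of_even {M : ℕ} (hM : Even M) :
    (-1 : Matrix (Fin M) (Fin M) ℂ) ∈ Matrix.specialUnitaryGroup (Fin M) ℂ := by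
  rw [Matrix.mem_specialUnitaryGroup_iff]
  refine ⟨(-1 : Matrix.unitaryGroup (Fin M) ℂ).2, ?_⟩
  rw [Matrix.det_neg, Matrix.det_one, mul_one, Fintype.card_fin]
  exact hM.neg_one_pow

/-- ★ **Link-hyperplane RP of `SU(M)` lattice Yang–Mills, `M` EVEN, on the even torus `(ℤ/2Q)^d`
along every axis at EVERY real `β`** (fundamental representation; `z = -1 ∈ SU(M)`; `Q ≥ 2`). -/
theorem cubicTorus_linkRP_suEven_anyBeta {M : ℕ} (hM : Even M) (hQ : 2 ≤ Q) (k : Fin d) (β : ℝ)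
    (F : GaugeConfig d (2 * Q) (Matrix.specialUnitaryGroup (Fin M) ℂ) → ℂ) (hFm : Measurable F)
    (hFb : ∃ C : ℝ, ∀ U, ‖F U‖ ≤ C)
    (hFo : IsMidObservable (cubicUnit d (2 * Q)) Q (cubicAxisCoord d (2 * Q) k) F) :
    0 ≤ ∫ U, conj (F (configMidReflect (cubicUnit d (2 * Q)) k (cubicAxisReflect d (2 * Q) k) U)) *
      F U ∂(wilsonMeasure (d := d) (L := 2 * Q) (fundamentalRep (Fin M)) β) := by
  haveI : SecondCountableTopology (Matrix (Fin M) (Fin M) ℂ) :=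
    inferInstanceAs (SecondCountableTopology (Fin M → Fin M → ℂ))
  haveI : SecondCountableTopology (Matrix.specialUnitaryGroup (Fin M) ℂ) :=
    Topology.IsEmbedding.subtypeVal.secondCountableTopology
  set z : Matrix.specialUnitaryGroup (Fin M) ℂ := ⟨-1, neg_one_mem_specialUnitaryGroup_of_even hM⟩
    with hz
  refine cubicTorus_linkRP_anyBeta_of_central (fundamentalRep (Fin M)) hQ k
    (continuous_fundamentalRep (Fin M)) (z := z) (fun g => ?_) ?_ ?_ β F hFm hFb hFo
  · exact Subtype.ext (by simp [hz])
  · exact Subtype.ext (by simp [hz])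
  · rw [fundamentalRep_apply]

/-- ★ **Link-hyperplane RP of `SU(2)` lattice Yang–Mills on the even torus `(ℤ/2Q)^d` along every
axis at EVERY real `β`** (the cell's gauge group of rows T1/T2; fundamental representation,
`z = -1 ∈ SU(2)`; `Q ≥ 2`). -/
theorem cubicTorus_linkRP_su2_anyBeta (hQ : 2 ≤ Q) (k : Fin d) (β : ℝ)
    (F : GaugeConfig d (2 * Q) (Matrix.specialUnitaryGroup (Fin 2) ℂ) → ℂ) (hFm : Measurable F)
    (hFb : ∃ C : ℝ, ∀ U, ‖F U‖ ≤ C)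
    (hFo : IsMidObservable (cubicUnit d (2 * Q)) Q (cubicAxisCoord d (2 * Q) k) F) :
    0 ≤ ∫ U, conj (F (configMidReflect (cubicUnit d (2 * Q)) k (cubicAxisReflect d (2 * Q) k) U)) *
      F U ∂(wilsonMeasure (d := d) (L := 2 * Q) (fundamentalRep (Fin 2)) β) :=
  cubicTorus_linkRP_suEven_anyBeta even_two hQ k β F hFm hFb hFo

end GaugeGroups

end TiltedRP

/-! ## In the cell's vocabulary: the `SU(2n)` plaquette expectation is odd in `β_std` -/

section Targets

open TiltedRP

/-- ★ **`⟨ū_P⟩_{(ℤ/L)^D, SU(M), -β_std} = -⟨ū_P⟩_{(ℤ/L)^D, SU(M), β_std}` for `M` even and `L` even**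
(Li–Meurice 2005: `P(β) + P(-β) = 2`, `P = 1 - ū_P`): the staggered central twist by `-1 ∈ SU(M)`
maps `wilsonMeasure` at tree coupling `β_std/M` onto the one at `-β_std/M` and reverses `ū_P`. In
particular for the cell's `SU(2)` (`M = 2`), every `D`, every even torus. -/
theorem plaquetteExpectation_neg_of_even {M : ℕ} (hM : Even M) (D L : ℕ) [NeZero L] (hL : Even L)
    (β : ℝ) : plaquetteExpectation M D L (-β) = -plaquetteExpectation M D L β := by
  haveI : SecondCountableTopology (Matrix (Fin M) (Fin M) ℂ) :=
    inferInstanceAs (SecondCountableTopology (Fin M → Fin M → ℂ))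
  haveI : SecondCountableTopology (Matrix.specialUnitaryGroup (Fin M) ℂ) :=
    Topology.IsEmbedding.subtypeVal.secondCountableTopology
  have h2 : 2 ∣ L := even_iff_two_dvd.1 hL
  set z : Matrix.specialUnitaryGroup (Fin M) ℂ := ⟨-1, neg_one_mem_specialUnitaryGroup_of_even hM⟩
    with hz
  have hzc : ∀ g, z * g = g * z := fun g => Subtype.ext (by simp [hz])
  have hz2 : z * z = 1 := Subtype.ext (by simp [hz])
  have hρz : suRep M z = -1 := rfl
  unfold plaquetteExpectation wilsonExpectation
  rw [neg_div]
  rcases isEmpty_or_nonempty (Fin D) with hD | hD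
  · -- no axis to put last: `d = 0`, no plaquettes, `ū_P = 0`
    have h0 : ∀ U : GaugeConfig D L (SU M), meanPlaquette (suRep M) U = 0 := fun U => by
      unfold meanPlaquette
      rw [Finset.sum_eq_zero fun p _ => (IsEmpty.false p.2.1.1).elim, mul_zero]
    simp [h0]
  · obtain ⟨r⟩ := hD
    rw [← cubicTorus_integral_comp_stagTwist (suRep M) h2 r (continuous_suRep M) hzc hz2 hρz (β / M)
      (meanPlaquette (suRep M))]
    simp_rw [meanPlaquette_centralTwist (suRep M)
      (isStaggering_stagTwist (isDualParity_cubicParity D L h2) r hzc hz2) hρz]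
    exact integral_neg _

/-- **Every plaquette window transfers to the negated coupling** (`M` even): if
`a ≤ ⟨ū_P⟩_{(ℤ/L)^D, SU(M), β} ≤ b` for all even `L ≥ L₀`, then
`-b ≤ ⟨ū_P⟩_{(ℤ/L)^D, SU(M), -β} ≤ -a` for all even `L ≥ L₀`. -/
theorem plaquetteWindow_neg_of_even {M : ℕ} (hM : Even M) {D L₀ : ℕ} {β a b : ℝ}
    (h : PlaquetteWindow M D L₀ β a b) : PlaquetteWindow M D L₀ (-β) (-b) (-a) := by
  intro L _ hL hL₀
  obtain ⟨ha, hb⟩ := h L hL hL₀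
  rw [plaquetteExpectation_neg_of_even hM D L hL]
  exact ⟨neg_le_neg hb, neg_le_neg ha⟩

/-- **The cell's `SU(2)`, `D = 3` rows hold at negative coupling with the negated window**:
`T1 L₀ β a b → T1 L₀ (-β) (-b) (-a)`. (No certificate of the cell is AT `β < 0`; this is the
symmetry, not a new row.) -/
theorem t1_neg {L₀ : ℕ} {β a b : ℝ} (h : T1 L₀ β a b) : T1 L₀ (-β) (-b) (-a) :=
  plaquetteWindow_neg_of_even even_two h

/-- **The cell's `SU(2)`, `D = 4` rows hold at negative coupling with the negated window**:
`T2 L₀ β a b → T2 L₀ (-β) (-b) (-a)`. -/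
theorem t2_neg {L₀ : ℕ} {β a b : ℝ} (h : T2 L₀ β a b) : T2 L₀ (-β) (-b) (-a) :=
  plaquetteWindow_neg_of_even even_two h

end Targets

end Summit.QuantumFields.GaugeBoot
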